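import Summits.NavierStokesRegularity.NavierStokesRegularity.Theses.AxisymmetricExtremality
import Literature.Analysis.FluidPDE.SereginSverakAxisymmetric
import Literature.Analysis.FluidPDE.CylindricalIntegration
import Literature.Analysis.Calculus.HardyLogarithmic
import Literature.Analysis.Calculus.PlanarPolarIntegral
import HarnessLib

/-!
# Seregin 2022, Lemma 2.2: the two-dimensional Leray (logarithmic Hardy) inequality on the unit
# cylinder — crux stmt-NavierStokesRegularity-15453 (`AxisymmetricExtremality.AxisymmetricKatoGlobal`), line registered, support for stub `stub_sereginLogSwirlOrigin`

Support file (`--supports stmt-NavierStokesRegularity-15453`; theorems only, everything proved)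
toward the registered stub `stub_sereginLogSwirlOrigin`, which is verbatim the named fact
`Literature.Analysis.FluidPDE.seregin2022_logSwirl_regularAtOrigin` (G. Seregin, *A note on local
regularity of axisymmetric solutions to the Navier–Stokes equations*, J. Math. Fluid Mech. 24
(2022), Paper 27 = arXiv:2201.00153, §2).  Step 3 of that proof absorbs the swirl terms `B₃`,
`A₀` with "a Leray type inequality in dimension two" (arXiv p. 6):

> **Lemma 2.2.** For any function `f ∈ C¹₀(𝒞)`, the following inequality is valid:
> `∫_𝒞 |f|²/(|x'|² ln²(e/|x'|)) dx ≤ 4 ∫_𝒞 |∇_{x'} f|² dx`.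
> The proof can be done with the help of integration by parts.

Here `𝒞 = {x : |x'| < 1, |x₃| < 1}` is the unit cylinder of `ℝ³`, `x' = (x₁, x₂, 0)`.  This file
proves Lemma 2.2 exactly in this form (`seregin2022_lemma22`): `f : ℝ³ → ℝ` of class `C¹` with
`tsupport f ⊆ 𝒞 = SereginSverak2009.spaceCyl 0 1`, `|x'| = cylRadius x`, the weight written as
`(cylRadius x)² · (log (exp 1 / cylRadius x))²` — the same expression as in the swirl hypothesis
(2.2) of the named fact — and `|∇_{x'} f|² = (Df[e₀])² + (Df[e₁])²`; together with

* `integrable_and_integral_sq_div_logWeight_le` — the same on `ℝ³` with the integrability of the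
  left-hand integrand (finite for `f ∈ C¹₀(𝒞)` although the weight is singular on the axis);
* `lintegral_sq_div_logWeight_le` — the `ℝ≥0∞` form on `ℝ³`, for every `f ∈ C¹(ℝ³)` that merely
  vanishes where `|x'| ≥ 1` (no support condition in `x₃`; the currency of the tree's energy
  estimates);
* `ray_lintegral_le`, `ray_logHardy` — the inequality along each horizontal ray
  `ρ ↦ (ρ cos θ, ρ sin θ, z)`, i.e. the printed integration by parts: the tree's
  `Literature.Analysis.Calculus.hardy_log_core` at `s = 1`
  (`∫₀¹ h²/(ρ(1 - ln ρ)²) ≤ 2h(1)² + 4∫₀¹ ρ h'²`, `1 - ln ρ = ln(e/ρ)`, `h(1) = 0`) and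
  `(∂_ρ f)² = (cos θ ∂₀f + sin θ ∂₁f)² ≤ (∂₀f)² + (∂₁f)²`;
* `lintegral_eq_lintegral_polar`, `lintegral_eq_lintegral_cylindrical` — Tonelli in polar
  coordinates on `EuclideanSpace ℝ (Fin 2)` and in cylindrical coordinates on
  `EuclideanSpace ℝ (Fin 3)` for lower Lebesgue integrals (no integrability proviso), assembled
  from Mathlib's `lintegral_comp_polarCoord_symm` and the tree's volume-preserving
  identifications `measurePreserving_toLp_fin_two` (`PlanarPolarIntegral`) and `cylSplit`
  (`CylindricalIntegration`).

Proof: `∫ = ∫ dz ∫ dθ ∫ ρ dρ` (Tonelli), the ray inequality for every `(θ, z)`, and back; the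
constant `4` is the printed (sharp) one.  Mathlib has no Hardy/Leray inequality; the tree's 1D
log-Hardy inequalities are `hardy_log_core` (used here) and `logHardy` (`LeiZhang2017LogHardy`).

## References

* G. Seregin, J. Math. Fluid Mech. 24 (2022), Paper No. 27 = arXiv:2201.00153, §2, Lemma 2.2
  (arXiv p. 6) and its use in Step 3. [`Seregin2022LocalAxisym`]
* J. Leray, J. Math. Pures Appl. 12 (1933), 1–82 (`∫ |u|²/(|x|² ln²|x|) ≤ 4 ∫ |∇u|²` in `ℝ²`).
-/

noncomputable section

open Set MeasureTheory Filter Topology Function Metric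
open scoped ENNReal NNReal
open Literature.Analysis.FluidPDE Literature.Analysis.Calculus

-- `<Problem> = <Summit>` duplicates a namespace component by design (lakefile sets the same option).
set_option linter.dupNamespace false

namespace Summit.NavierStokesRegularity.NavierStokesRegularity.Theorems.AxisymmetricKatoGlobal.EulerScaling

/-! ### Polar and cylindrical coordinates for lower Lebesgue integrals -/

/-- The polar map `(ρ, θ) ↦ (ρ cos θ, ρ sin θ)` into `EuclideanSpace ℝ (Fin 2)` is continuous.
[folklore] -/
theorem continuous_polarPt :
    Continuous fun p : ℝ × ℝ => (WithLp.toLp 2 ![p.1 * Real.cos p.2, p.1 * Real.sin p.2] : EuclideanSpace ℝ (Fin 2)) := by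
  refine (PiLp.continuous_toLp 2 _).comp (continuous_pi fun i => ?_)
  fin_cases i
  · exact continuous_fst.mul (Real.continuous_cos.comp continuous_snd)
  · exact continuous_fst.mul (Real.continuous_sin.comp continuous_snd)

/-- **Tonelli in polar coordinates on `EuclideanSpace ℝ (Fin 2)`** (lower Lebesgue integrals, no
integrability proviso): `∫⁻ F = ∫⁻_{θ ∈ (-π, π)} ∫⁻_{ρ > 0} ρ F(ρ cos θ, ρ sin θ)`. [folklore] -/
theorem lintegral_eq_lintegral_polar {F : EuclideanSpace ℝ (Fin 2) → ℝ≥0∞} (hF : Measurable F) :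
    ∫⁻ w, F w = ∫⁻ θ in Ioo (-Real.pi) Real.pi, ∫⁻ ρ in Ioi (0 : ℝ),
      ENNReal.ofReal ρ * F (WithLp.toLp 2 ![ρ * Real.cos θ, ρ * Real.sin θ]) := by
  have h1 : ∫⁻ w, F w = ∫⁻ q : ℝ × ℝ, F (WithLp.toLp 2 ![q.1, q.2]) :=
    (measurePreserving_toLp_fin_two.lintegral_comp_emb measurableEmbedding_toLp_fin_two F).symm
  have h2 := lintegral_comp_polarCoord_symm (fun q : ℝ × ℝ => F (WithLp.toLp 2 ![q.1, q.2]))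
  rw [h1, ← h2, volume_restrict_polarCoord_target]
  simp only [polarCoord_symm_apply, smul_eq_mul]
  have hm : Measurable fun p : ℝ × ℝ =>
      ENNReal.ofReal p.1 * F (WithLp.toLp 2 ![p.1 * Real.cos p.2, p.1 * Real.sin p.2]) :=
    (ENNReal.measurable_ofReal.comp measurable_fst).mul (hF.comp continuous_polarPt.measurable)
  rw [lintegral_prod_symm _ hm.aemeasurable]

/-- **Tonelli in cylindrical coordinates on `EuclideanSpace ℝ (Fin 3)`** (lower Lebesgue
integrals): `∫⁻ G = ∫⁻_z ∫⁻_{θ ∈ (-π, π)} ∫⁻_{ρ > 0} ρ G(ρ cos θ, ρ sin θ, z)`. [folklore] -/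
theorem lintegral_eq_lintegral_cylindrical {G : EuclideanSpace ℝ (Fin 3) → ℝ≥0∞} (hG : Measurable G) :
    ∫⁻ x, G x = ∫⁻ z : ℝ, ∫⁻ θ in Ioo (-Real.pi) Real.pi, ∫⁻ ρ in Ioi (0 : ℝ),
      ENNReal.ofReal ρ * G (WithLp.toLp 2 ![ρ * Real.cos θ, ρ * Real.sin θ, z]) := by
  have h1 : ∫⁻ x, G x = ∫⁻ p : ℝ × EuclideanSpace ℝ (Fin 2), G (cylSplit.symm p) :=
    (measurePreserving_cylSplit_symm.lintegral_comp_emb cylSplit.symm.measurableEmbedding G).symm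
  have hGm : Measurable fun p : ℝ × EuclideanSpace ℝ (Fin 2) => G (cylSplit.symm p) := hG.comp cylSplit.symm.measurable
  rw [h1, Measure.volume_eq_prod, lintegral_prod _ hGm.aemeasurable]
  refine lintegral_congr fun z => ?_
  rw [lintegral_eq_lintegral_polar (F := fun w => G (cylSplit.symm (z, w)))
    (hGm.comp measurable_prodMk_left)]
  simp only [cylSplit_symm_apply, Matrix.cons_val_zero, Matrix.cons_val_one]

/-! ### The ray inequality -/

/-- **The radial integration by parts** (the tree's `hardy_log_core` at `s = 1`; `1 - ln ρ =
ln(e/ρ)`): for `h ∈ C¹(ℝ)` with `h 1 = 0`, `∫₀¹ h²/(ρ (1 - ln ρ)²) dρ ≤ 4 ∫₀¹ ρ h'² dρ`. [cite: Seregin2022LocalAxisym, Lemma 2.2 (proof: "integration by parts")] -/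
theorem ray_logHardy {h h' : ℝ → ℝ} (hh : ∀ x, HasDerivAt h (h' x) x) (hh' : Continuous h')
    (h1 : h 1 = 0) :
    ∫ ρ in Ioo (0 : ℝ) 1, h ρ ^ 2 / (ρ * (1 - Real.log ρ) ^ 2) ≤
      4 * ∫ ρ in Ioo (0 : ℝ) 1, ρ * h' ρ ^ 2 := by
  have := hardy_log_core one_pos (f := h) (f' := h') (fun x _ => hh x) hh'.continuousOn
  simpa [div_one, h1] using this

/-- The cylindrical radius of the point `(ρ cos θ, ρ sin θ, z)` is `|ρ|`. [folklore] -/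
theorem cylRadius_cylPt (ρ θ z : ℝ) :
    cylRadius (WithLp.toLp 2 ![ρ * Real.cos θ, ρ * Real.sin θ, z] : EuclideanSpace ℝ (Fin 3)) = |ρ| := by
  rw [cylRadius]
  have e : (ρ * Real.cos θ) ^ 2 + (ρ * Real.sin θ) ^ 2 = ρ ^ 2 := by
    linear_combination ρ ^ 2 * Real.sin_sq_add_cos_sq θ
  simp only [Matrix.cons_val_zero, Matrix.cons_val_one]
  rw [e, Real.sqrt_sq_eq_abs]

/-- **The ray form of Lemma 2.2 in `ℝ≥0∞`.** For `f ∈ C¹(ℝ³)` vanishing where `|x'| ≥ 1` and a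
ray `ρ ↦ (ρ cos θ, ρ sin θ, z)`:
`∫_{ρ>0} ρ · f²/(|x'|² ln²(e/|x'|)) ≤ 4 ∫_{ρ>0} ρ · ((∂₀f)² + (∂₁f)²)` along the ray (the radial
integration by parts `ray_logHardy` plus `(∂_ρ f)² ≤ (∂₀f)² + (∂₁f)²`).
[cite: Seregin2022LocalAxisym, Lemma 2.2 (arXiv:2201.00153 p. 6)] -/
theorem ray_lintegral_le {f : EuclideanSpace ℝ (Fin 3) → ℝ} (hf : ContDiff ℝ 1 f)
    (hf0 : ∀ x, 1 ≤ cylRadius x → f x = 0) (θ z : ℝ) :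
    ∫⁻ ρ in Ioi (0 : ℝ), ENNReal.ofReal ρ * ENNReal.ofReal
        (f (WithLp.toLp 2 ![ρ * Real.cos θ, ρ * Real.sin θ, z]) ^ 2 /
          (cylRadius (WithLp.toLp 2 ![ρ * Real.cos θ, ρ * Real.sin θ, z] : EuclideanSpace ℝ (Fin 3)) ^ 2 *
            Real.log (Real.exp 1 /
              cylRadius (WithLp.toLp 2 ![ρ * Real.cos θ, ρ * Real.sin θ, z] : EuclideanSpace ℝ (Fin 3))) ^ 2)) ≤
      4 * ∫⁻ ρ in Ioi (0 : ℝ), ENNReal.ofReal ρ * ENNReal.ofReal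
        (fderiv ℝ f (WithLp.toLp 2 ![ρ * Real.cos θ, ρ * Real.sin θ, z])
            (EuclideanSpace.single 0 1) ^ 2 +
          fderiv ℝ f (WithLp.toLp 2 ![ρ * Real.cos θ, ρ * Real.sin θ, z])
            (EuclideanSpace.single 1 1) ^ 2) := by
  -- the ray as an affine map `ρ ↦ ρ • v + c`
  set v : EuclideanSpace ℝ (Fin 3) := WithLp.toLp 2 ![Real.cos θ, Real.sin θ, 0] with hv
  set c : EuclideanSpace ℝ (Fin 3) := WithLp.toLp 2 ![0, 0, z] with hc
  set γ : ℝ → EuclideanSpace ℝ (Fin 3) := fun ρ => WithLp.toLp 2 ![ρ * Real.cos θ, ρ * Real.sin θ, z] with hγ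
  have hγ_eq : ∀ ρ : ℝ, γ ρ = ρ • v + c := by
    intro ρ
    ext i
    fin_cases i <;> simp [hγ, hv, hc]
  have hγd : ∀ ρ : ℝ, HasDerivAt γ v ρ := by
    intro ρ
    have e : γ = fun ρ => ρ • v + c := funext hγ_eq
    rw [e]
    simpa using ((hasDerivAt_id ρ).smul_const v).add_const c
  have hγc : Continuous γ := continuous_iff_continuousAt.2 fun ρ => (hγd ρ).continuousAt
  -- the profile `h = f ∘ γ` and its derivative `h' = Df(γ)[v]`
  set h : ℝ → ℝ := fun ρ => f (γ ρ) with hh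
  set h' : ℝ → ℝ := fun ρ => fderiv ℝ f (γ ρ) v with hh'
  have hd : ∀ ρ, HasDerivAt h (h' ρ) ρ := fun ρ =>
    ((hf.differentiable one_ne_zero) _).hasFDerivAt.comp_hasDerivAt ρ (hγd ρ)
  have hDf : Continuous (fderiv ℝ f) := hf.continuous_fderiv one_ne_zero
  have hc' : Continuous h' := (hDf.comp hγc).clm_apply continuous_const
  have hhc : Continuous h := hf.continuous.comp hγc
  have hrad : ∀ ρ : ℝ, cylRadius (γ ρ) = |ρ| := fun ρ => cylRadius_cylPt ρ θ z
  have h1 : h 1 = 0 := hf0 _ (by rw [hrad 1, abs_one])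
  -- `(∂_ρ f)² ≤ (∂₀ f)² + (∂₁ f)²`
  set R : ℝ → ℝ := fun ρ => fderiv ℝ f (γ ρ) (EuclideanSpace.single 0 1) ^ 2 +
    fderiv ℝ f (γ ρ) (EuclideanSpace.single 1 1) ^ 2 with hR
  have hv_dec : v = Real.cos θ • EuclideanSpace.single (0 : Fin 3) (1 : ℝ) +
      Real.sin θ • EuclideanSpace.single (1 : Fin 3) (1 : ℝ) := by
    ext i
    fin_cases i <;> simp [hv]
  have hD8 : ∀ ρ, h' ρ ^ 2 ≤ R ρ := by
    intro ρ
    simp only [hh', hR]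
    rw [hv_dec, map_add, map_smul, map_smul, smul_eq_mul, smul_eq_mul]
    set a := fderiv ℝ f (γ ρ) (EuclideanSpace.single 0 1)
    set b := fderiv ℝ f (γ ρ) (EuclideanSpace.single 1 1)
    have key : a ^ 2 + b ^ 2 - (Real.cos θ * a + Real.sin θ * b) ^ 2 =
        (Real.cos θ * b - Real.sin θ * a) ^ 2 := by
      linear_combination (-(a ^ 2 + b ^ 2)) * Real.sin_sq_add_cos_sq θ
    nlinarith [sq_nonneg (Real.cos θ * b - Real.sin θ * a)]
  -- the two one-dimensional integrands and their integrability on `(0, 1)`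
  set L : ℝ → ℝ := fun ρ => h ρ ^ 2 / (ρ * (1 - Real.log ρ) ^ 2) with hL
  set Q : ℝ → ℝ := fun ρ => ρ * h' ρ ^ 2 with hQ
  have hLi : IntegrableOn L (Ioo 0 1) := by
    have := integrableOn_sq_div_mul_log_sq one_pos (hhc.continuousOn (s := Icc 0 1))
    simp only [div_one] at this
    exact this.mono_set Ioo_subset_Ioc_self
  have hQi : IntegrableOn Q (Ioo 0 1) :=
    ((continuous_id.mul (hc'.pow 2)).integrableOn_Icc (a := 0) (b := 1)).mono_set
      Ioo_subset_Icc_self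
  have hL_nn : 0 ≤ᵐ[volume.restrict (Ioo (0 : ℝ) 1)] L :=
    (ae_restrict_iff' measurableSet_Ioo).2 (Eventually.of_forall fun ρ hρ => by
      simp only [hL, Pi.zero_apply]
      have := hρ.1
      positivity)
  have hQ_nn : 0 ≤ᵐ[volume.restrict (Ioo (0 : ℝ) 1)] Q :=
    (ae_restrict_iff' measurableSet_Ioo).2 (Eventually.of_forall fun ρ hρ => by
      simp only [hQ, Pi.zero_apply]
      exact mul_nonneg hρ.1.le (sq_nonneg _))
  have hardy : ∫ ρ in Ioo (0 : ℝ) 1, L ρ ≤ 4 * ∫ ρ in Ioo (0 : ℝ) 1, Q ρ := ray_logHardy hd hc' h1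
  -- the left-hand side lives on `(0, 1)` and equals `∫₀¹ L`
  have hLHS_pt : ∀ ρ ∈ Ioi (0 : ℝ), ENNReal.ofReal ρ * ENNReal.ofReal
      (f (γ ρ) ^ 2 / (cylRadius (γ ρ) ^ 2 * Real.log (Real.exp 1 / cylRadius (γ ρ)) ^ 2)) =
      (Ioo (0 : ℝ) 1).indicator (fun ρ => ENNReal.ofReal (L ρ)) ρ := by
    intro ρ hρ
    have hρ0 : 0 < ρ := hρ
    rw [hrad ρ, abs_of_pos hρ0]
    by_cases hρ1 : ρ < 1
    · rw [indicator_of_mem (show ρ ∈ Ioo (0 : ℝ) 1 from ⟨hρ0, hρ1⟩),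
        ← ENNReal.ofReal_mul hρ0.le]
      congr 1
      have hlog : Real.log (Real.exp 1 / ρ) = 1 - Real.log ρ := by
        rw [Real.log_div (Real.exp_pos 1).ne' hρ0.ne', Real.log_exp]
      simp only [hL, hh, hlog]
      field_simp
    · rw [indicator_of_notMem (fun hm : ρ ∈ Ioo (0 : ℝ) 1 => hρ1 hm.2)]
      have : f (γ ρ) = 0 := hf0 _ (by rw [hrad ρ, abs_of_pos hρ0]; exact not_lt.1 hρ1)
      simp [this]
  have hLHS : ∫⁻ ρ in Ioi (0 : ℝ), ENNReal.ofReal ρ * ENNReal.ofReal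
      (f (γ ρ) ^ 2 / (cylRadius (γ ρ) ^ 2 * Real.log (Real.exp 1 / cylRadius (γ ρ)) ^ 2)) =
      ENNReal.ofReal (∫ ρ in Ioo (0 : ℝ) 1, L ρ) := by
    rw [setLIntegral_congr_fun measurableSet_Ioi hLHS_pt, lintegral_indicator measurableSet_Ioo,
      Measure.restrict_restrict measurableSet_Ioo, inter_eq_left.2 Ioo_subset_Ioi_self,
      ofReal_integral_eq_lintegral_ofReal hLi hL_nn]
  -- the right-hand side dominates `4 ∫₀¹ Q`
  have hRHS : ENNReal.ofReal (4 * ∫ ρ in Ioo (0 : ℝ) 1, Q ρ) ≤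
      4 * ∫⁻ ρ in Ioi (0 : ℝ), ENNReal.ofReal ρ * ENNReal.ofReal (R ρ) := by
    rw [ENNReal.ofReal_mul (by norm_num : (0 : ℝ) ≤ 4), ENNReal.ofReal_ofNat,
      ofReal_integral_eq_lintegral_ofReal hQi hQ_nn]
    refine mul_le_mul_right ((setLIntegral_mono' measurableSet_Ioo fun ρ hρ => ?_).trans
      (lintegral_mono_set Ioo_subset_Ioi_self)) 4
    rw [← ENNReal.ofReal_mul hρ.1.le]
    exact ENNReal.ofReal_le_ofReal (mul_le_mul_of_nonneg_left (hD8 ρ) hρ.1.le)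
  -- assemble
  change ∫⁻ ρ in Ioi (0 : ℝ), ENNReal.ofReal ρ * ENNReal.ofReal
      (f (γ ρ) ^ 2 / (cylRadius (γ ρ) ^ 2 * Real.log (Real.exp 1 / cylRadius (γ ρ)) ^ 2)) ≤
    4 * ∫⁻ ρ in Ioi (0 : ℝ), ENNReal.ofReal ρ * ENNReal.ofReal (R ρ)
  rw [hLHS]
  exact (ENNReal.ofReal_le_ofReal hardy).trans hRHS

/-! ### Lemma 2.2 on `ℝ³` and on the cylinder `𝒞` -/

/-- **Seregin 2022, Lemma 2.2, `ℝ≥0∞` form on `ℝ³`.** For `f ∈ C¹(ℝ³)` vanishing where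
`|x'| ≥ 1` (no assumption in `x₃`),
`∫ f²/(|x'|² ln²(e/|x'|)) dx ≤ 4 ∫ ((∂₀f)² + (∂₁f)²) dx = 4 ∫ |∇_{x'} f|² dx`
as lower Lebesgue integrals (cylindrical Tonelli + the ray inequality).
[cite: Seregin2022LocalAxisym, Lemma 2.2 (arXiv:2201.00153 p. 6)] -/
theorem lintegral_sq_div_logWeight_le {f : EuclideanSpace ℝ (Fin 3) → ℝ} (hf : ContDiff ℝ 1 f)
    (hf0 : ∀ x, 1 ≤ cylRadius x → f x = 0) :
    ∫⁻ x, ENNReal.ofReal (f x ^ 2 / (cylRadius x ^ 2 * Real.log (Real.exp 1 / cylRadius x) ^ 2)) ≤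
      4 * ∫⁻ x, ENNReal.ofReal (fderiv ℝ f x (EuclideanSpace.single 0 1) ^ 2 +
        fderiv ℝ f x (EuclideanSpace.single 1 1) ^ 2) := by
  have hWm : Measurable fun x : EuclideanSpace ℝ (Fin 3) =>
      ENNReal.ofReal (f x ^ 2 / (cylRadius x ^ 2 * Real.log (Real.exp 1 / cylRadius x) ^ 2)) := by
    refine ENNReal.measurable_ofReal.comp ?_
    exact (hf.continuous.measurable.pow_const 2).div
      ((continuous_cylRadius.measurable.pow_const 2).mul
        ((Real.measurable_log.comp (measurable_const.div continuous_cylRadius.measurable)).pow_const 2))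
  have hDf : Continuous (fderiv ℝ f) := hf.continuous_fderiv one_ne_zero
  have hRm : Measurable fun x : EuclideanSpace ℝ (Fin 3) => ENNReal.ofReal (fderiv ℝ f x (EuclideanSpace.single 0 1) ^ 2 +
      fderiv ℝ f x (EuclideanSpace.single 1 1) ^ 2) :=
    ENNReal.measurable_ofReal.comp (((hDf.clm_apply continuous_const).pow 2).add
      ((hDf.clm_apply continuous_const).pow 2)).measurable
  rw [lintegral_eq_lintegral_cylindrical hWm, lintegral_eq_lintegral_cylindrical hRm,
    ← lintegral_const_mul' _ _ ENNReal.ofNat_ne_top]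
  refine lintegral_mono fun z => ?_
  rw [← lintegral_const_mul' _ _ ENNReal.ofNat_ne_top]
  refine lintegral_mono fun θ => ?_
  exact ray_lintegral_le hf hf0 θ z

/-- A `C¹` function with `tsupport f ⊆ 𝒞` vanishes where `|x'| ≥ 1`. [folklore] -/
theorem eq_zero_of_one_le_cylRadius {f : EuclideanSpace ℝ (Fin 3) → ℝ}
    (hsupp : tsupport f ⊆ SereginSverak2009.spaceCyl 0 1) (x : EuclideanSpace ℝ (Fin 3)) (hx : 1 ≤ cylRadius x) :
    f x = 0 := by
  by_contra hne
  have hx' : x ∈ SereginSverak2009.spaceCyl 0 1 := hsupp (subset_tsupport f (mem_support.2 hne))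
  rw [SereginSverak2009.mem_spaceCyl, sub_zero] at hx'
  linarith [hx'.1]

/-- `𝒞 = 𝒞(0, 1)` is bounded: it lies in the closed ball of radius `2`. [folklore] -/
theorem spaceCyl_subset_closedBall :
    SereginSverak2009.spaceCyl (0 : EuclideanSpace ℝ (Fin 3)) 1 ⊆ closedBall (0 : EuclideanSpace ℝ (Fin 3)) 2 := by
  intro x hx
  rw [SereginSverak2009.mem_spaceCyl, sub_zero] at hx
  obtain ⟨h1, h2⟩ := hx
  have h2' : |x 2| < 1 := by simpa using h2
  have hr2 : x 0 ^ 2 + x 1 ^ 2 < 1 := by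
    rw [← cylRadius_sq]
    nlinarith [cylRadius_nonneg x]
  have hz2 : x 2 ^ 2 < 1 := by
    have := abs_lt.1 h2'
    nlinarith
  rw [mem_closedBall, dist_zero_right, EuclideanSpace.norm_eq, Fin.sum_univ_three]
  simp only [Real.norm_eq_abs, sq_abs]
  rw [Real.sqrt_le_iff]
  constructor
  · norm_num
  · nlinarith

/-- **Seregin 2022, Lemma 2.2 (the two-dimensional Leray inequality), on `ℝ³`.** For
`f ∈ C¹₀(𝒞)` — `f ∈ C¹(ℝ³)` with `tsupport f ⊆ 𝒞 = {|x'| < 1, |x₃| < 1}` — the function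
`f²/(|x'|² ln²(e/|x'|))` is integrable and
`∫ f²/(|x'|² ln²(e/|x'|)) dx ≤ 4 ∫ ((∂₀f)² + (∂₁f)²) dx = 4 ∫ |∇_{x'} f|² dx`.
[cite: Seregin2022LocalAxisym, Lemma 2.2 (arXiv:2201.00153 p. 6)] -/
theorem integrable_and_integral_sq_div_logWeight_le {f : EuclideanSpace ℝ (Fin 3) → ℝ} (hf : ContDiff ℝ 1 f)
    (hsupp : tsupport f ⊆ SereginSverak2009.spaceCyl 0 1) :
    Integrable (fun x => f x ^ 2 / (cylRadius x ^ 2 * Real.log (Real.exp 1 / cylRadius x) ^ 2)) ∧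
    ∫ x, f x ^ 2 / (cylRadius x ^ 2 * Real.log (Real.exp 1 / cylRadius x) ^ 2) ≤
      4 * ∫ x, (fderiv ℝ f x (EuclideanSpace.single 0 1) ^ 2 +
        fderiv ℝ f x (EuclideanSpace.single 1 1) ^ 2) := by
  set W : EuclideanSpace ℝ (Fin 3) → ℝ := fun x => f x ^ 2 / (cylRadius x ^ 2 * Real.log (Real.exp 1 / cylRadius x) ^ 2)
    with hW
  set R : EuclideanSpace ℝ (Fin 3) → ℝ := fun x => fderiv ℝ f x (EuclideanSpace.single 0 1) ^ 2 +
    fderiv ℝ f x (EuclideanSpace.single 1 1) ^ 2 with hR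
  have hf0 : ∀ x, 1 ≤ cylRadius x → f x = 0 := eq_zero_of_one_le_cylRadius hsupp
  have hcs : HasCompactSupport f :=
    IsCompact.of_isClosed_subset (isCompact_closedBall (0 : EuclideanSpace ℝ (Fin 3)) 2) (isClosed_tsupport f)
      (hsupp.trans spaceCyl_subset_closedBall)
  -- measurability / integrability bookkeeping
  have hW_nn : ∀ x, 0 ≤ W x := fun x => by
    simp only [hW]
    positivity
  have hW_meas : Measurable W :=
    (hf.continuous.measurable.pow_const 2).div
      ((continuous_cylRadius.measurable.pow_const 2).mul
        ((Real.measurable_log.comp (measurable_const.div continuous_cylRadius.measurable)).pow_const 2))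
  have hDf : Continuous (fderiv ℝ f) := hf.continuous_fderiv one_ne_zero
  have hR_cont : Continuous R :=
    ((hDf.clm_apply continuous_const).pow 2).add ((hDf.clm_apply continuous_const).pow 2)
  have hR_cs : HasCompactSupport R := by
    refine HasCompactSupport.intro hcs fun x hx => ?_
    have : fderiv ℝ f x = 0 := fderiv_of_notMem_tsupport ℝ hx
    simp [hR, this]
  have hR_int : Integrable R := hR_cont.integrable_of_hasCompactSupport hR_cs
  have hR_nn : ∀ x, 0 ≤ R x := fun x => by
    simp only [hR]
    positivity
  -- the key inequality in `ℝ≥0∞`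
  have hkey : ∫⁻ x, ENNReal.ofReal (W x) ≤ 4 * ∫⁻ x, ENNReal.ofReal (R x) :=
    lintegral_sq_div_logWeight_le hf hf0
  have hRlt : ∫⁻ x, ENNReal.ofReal (R x) < ∞ := by
    rw [← ofReal_integral_eq_lintegral_ofReal hR_int (Eventually.of_forall hR_nn)]
    exact ENNReal.ofReal_lt_top
  have h4Rlt : 4 * ∫⁻ x, ENNReal.ofReal (R x) < ∞ := ENNReal.mul_lt_top (by simp) hRlt
  have hWlt : ∫⁻ x, ENNReal.ofReal (W x) < ∞ := hkey.trans_lt h4Rlt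
  have hW_int : Integrable W :=
    ⟨hW_meas.aestronglyMeasurable,
      (hasFiniteIntegral_iff_ofReal (Eventually.of_forall hW_nn)).2 hWlt⟩
  refine ⟨hW_int, ?_⟩
  rw [integral_eq_lintegral_of_nonneg_ae (Eventually.of_forall hW_nn) hW_meas.aestronglyMeasurable,
    integral_eq_lintegral_of_nonneg_ae (Eventually.of_forall hR_nn)
      hR_cont.measurable.aestronglyMeasurable]
  have := ENNReal.toReal_mono h4Rlt.ne hkey
  rwa [ENNReal.toReal_mul, ENNReal.toReal_ofNat] at this

/-- **Seregin 2022, Lemma 2.2, as printed** ("For any function `f ∈ C¹₀(𝒞)`, the following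
inequality is valid: `∫_𝒞 |f|²/(|x'|² ln²(e/|x'|)) dx ≤ 4 ∫_𝒞 |∇_{x'} f|² dx`", `𝒞` the unit
cylinder `{|x'| < 1, |x₃| < 1}` of `ℝ³`, `|∇_{x'} f|² = (∂₁f)² + (∂₂f)²`): rendered for
`f ∈ C¹(ℝ³)` with `tsupport f ⊆ 𝒞 = SereginSverak2009.spaceCyl 0 1`, the weight written with
`cylRadius x = |x'|` exactly as in the swirl hypothesis (2.2) of the named fact
`seregin2022_logSwirl_regularAtOrigin`. The Leray-type inequality used in Step 3 of the proof of
Thm. 1.2 to absorb the terms `B₃`, `A₀`. [cite: Seregin2022LocalAxisym, Lemma 2.2 (arXiv:2201.00153 p. 6)] -/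
theorem seregin2022_lemma22 : ∀ (f : EuclideanSpace ℝ (Fin 3) → ℝ), ContDiff ℝ 1 f → tsupport f ⊆ SereginSverak2009.spaceCyl 0 1 → ∫ x in SereginSverak2009.spaceCyl 0 1, f x ^ 2 / (cylRadius x ^ 2 * Real.log (Real.exp 1 / cylRadius x) ^ 2) ≤ 4 * ∫ x in SereginSverak2009.spaceCyl 0 1, (fderiv ℝ f x (EuclideanSpace.single 0 1) ^ 2 + fderiv ℝ f x (EuclideanSpace.single 1 1) ^ 2) := by
  intro f hf hsupp
  have hWz : ∀ x, x ∉ SereginSverak2009.spaceCyl (0 : EuclideanSpace ℝ (Fin 3)) 1 →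
      f x ^ 2 / (cylRadius x ^ 2 * Real.log (Real.exp 1 / cylRadius x) ^ 2) = 0 := by
    intro x hx
    have : f x = 0 := image_eq_zero_of_notMem_tsupport fun h => hx (hsupp h)
    simp [this]
  have hRz : ∀ x, x ∉ SereginSverak2009.spaceCyl (0 : EuclideanSpace ℝ (Fin 3)) 1 →
      fderiv ℝ f x (EuclideanSpace.single 0 1) ^ 2 +
        fderiv ℝ f x (EuclideanSpace.single 1 1) ^ 2 = 0 := by
    intro x hx
    have : fderiv ℝ f x = 0 := fderiv_of_notMem_tsupport ℝ fun h => hx (hsupp h)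
    simp [this]
  rw [setIntegral_eq_integral_of_forall_compl_eq_zero hWz,
    setIntegral_eq_integral_of_forall_compl_eq_zero hRz]
  exact (integrable_and_integral_sq_div_logWeight_le hf hsupp).2

end Summit.NavierStokesRegularity.NavierStokesRegularity.Theorems.AxisymmetricKatoGlobal.EulerScaling

end
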